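import Summits.QuantumFields.YangMills.Theorems.BalabanUVNodesN15KingModelAnalyticWindow
import Summits.QuantumFields.YangMills.Theorems.BalabanUVNodesN15KingModelCombesThomasBlockField
import HarnessLib

/-!
# BalabanUVNodes ∕ N15 — THE KING-MODEL RUNG (PART Ϩ-l): KING's EFFECTIVE LAPLACIAN IN THE COMPLEX WINDOW — the continued sandwich `Q(U)G(U,V)Q♯_K(V)` (`Q♯_K = L^{d+1}Q♯`, King's `η`-adjoint
# continued) and `Δ_eff(U,V) = a·1 − a²Q(U)G(U,V)Q♯_K(V)` keep KING's (4.34)(ii) BLOCK DECAY `e^{−κ_w·d_M(y,y′)}` at every two-sided complex field of PART Ϩ-e's window, with Dimock's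
# bilinear currency (test fields `Q(U)ᴴ(δ_y⊗u)`, `Q♯_K(V)(δ_{y′}⊗u′)` of size `(1+ε)^{D}` on their blocks); on print's slice at Bałaban's radius: `‖blk Δ_eff(U,U⁻¹) y y′‖ ≤ (a + a²(8∕κ)e³)·e^{−ctRate(κ∕2,a,d)d_M(y,y′)}`
# (Track A, DAG node N15 = NE2; FAN-OUT v1.1 §N15 s3 «KING-MODEL RUNG … + what the curved case adds»; count-neutral)

HONEST FRAMING.  Count-neutral (cell `pub-ymgap`, seat `pub-ymgap-dag-n15-e` g51; `--supports stmt-QuantumFields-27247 --as helper` = K3ᴬ, KEY MAP v3).  King's one-level comparison model;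
the window and the bilinear Combes–Thomas bound are PART Ϩ-e∕Ϩ-g; this file redoes PART Ϧ-e's sandwich bookkeeping with NON-unitary transports (`‖U(Γ)‖ ≤ (1+ε)^{depth}`, Ϩ-d) and the
continued `Q♯`.  `Δ_eff(U,V)` is the holomorphic family through King's `Δ_eff(U)` (PART Ϥ-k `effLapU`, slice `V = Uᴴ`).  NOT the block-field COVARIANCE `(Δ_eff)⁻¹` in the window (successor);
NOT Bałaban's multi-level objects; NOT a node discharge (N15 of record untouched); nothing continuum ∕ ℝ⁴ ∕ OS ∕ Clay.

THE RESULTS (`T` a tree contour system of depth `≤ D`, `M` the block torus):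
* §1 defs **`cxKingQadj T M V = L^{d+1}·Q♯(V)`**, **`cxEffLap T M a c m² U V = a·1 − a²·Q(U)·G(U,V)·Q♯_K(V)`**; `cxKingQadj_adjoint` (`= kingQadjU U` at `V = Uᴴ`), ★★ `cxEffLap_adjoint` (`Δ_eff(U,Uᴴ) = effLapU U`,
  every `U`), ★ `cxEffLap_inv_of_unitary` (`Δ_eff(U,U⁻¹) = Δ_eff(U)`, unitary `U`), `blk_cxEffLap`.
* §2 test fields: `fib_conjTranspose_covQ_mulVec_siteVec_site` (`(Q(U)ᴴ(δ_y⊗u))(x_j) = L^{−(d+1)}U(Γ_j)ᴴu`), `fib_cxQadj_mulVec_siteVec_of_ne`∕`_site` (support `B(y′)`, value `L^{−(d+1)}V(Γ_{x_j,y′})u′`),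
  `sum_norm_fib_sq_block` (a block sum), ★ `norm_sq_conjTranspose_covQ_siteVec_le`, ★ `norm_sq_cxQadj_siteVec_le` (`≤ L^{−(d+1)}((1+ε)^{D}‖u‖)²` near a unitary `U₀`).
* §3 ★★★ **`norm_blk_cxSandwich_le_of_near`** (PART Ϩ-e's weighted budget `γ` ⟹ `‖blk (Q(U)G(U,V)Q♯_K(V)) y y′‖ ≤ γ⁻¹e²(1+ε₁)^{2D}·e^{−κ_w d_M(y,y′)}`), ★★★ **`norm_blk_cxEffLap_le_of_near`**
  (`‖blk Δ_eff(U,V) y y′‖ ≤ (a + a²γ⁻¹e²(1+ε₁)^{2D})·e^{−κ_w d_M(y,y′)}` — KING's (4.34)(ii) AT A COMPLEX FIELD).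
* §4 KING SCALING ON PRINT's SLICE AT THE RADIUS (`c = L²`, comb depth, `L ≥ 1`, unitary `κ`-coercive `U₀`, `‖U_b − U₀_b‖ ≤ ε`, `Lε ≤ s₀(κ,a,d)`): ★★★★ **`norm_blk_cxEffLap_at_radius_le`**
  (`‖blk Δ_eff(U,U⁻¹) y y′‖ ≤ (a + a²(8∕κ)e³)·e^{−ctRate(κ∕2,a,d)·d_M(y,y′)}` — (4.34)(ii)'s SHAPE, `η`-uniform constants, IN THE COMPLEX POLYDISC), ★★★ `norm_blk_cxSandwich_at_radius_le`.
PRIOR TREE ART (by name): Ϧ-e (`l2_opNorm_le_of_bilinear`, `star_dotProduct_blk_mulVec`, `star_dotProduct_mul_mul_mulVec`, `norm_expWt_le_of_le`, `fib_conjTranspose_covQ_mulVec_siteVec`, `ctW_le_on_block`, `ctW_ge_on_block`),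
Ϩ-e (`norm_star_dotProduct_cxFullOp_inv_mulVec_le_of_near`, `king_tilt_bookkeeping`), Ϩ-f (`slice_near_*`), Ϩ-g (`sliceRadius`, `slice_budgets`, `tau_slice_le`), Ϩ-d (`norm_treeHol_le_pow_of_near`,
`norm_treeHolRev_le_pow_of_near`), Ϩ-a (`cxQadj`, `cxQadj_apply_site`, `cxQadj_adjoint`, `cxFullOp_adjoint`), Ϧ-a (`siteVec`, `norm_siteVec`), Ϥ-k (`effLapU`), Mathlib.  Dedup (rg at filing): basename 0 files;
needles `cxKingQadj|cxEffLap|cxSandwich` 0 tree files.  Locators: [King1986] (2.14) p.653, (4.5) p.670, (4.34) p.674; [Balaban1985BackgroundPropagators] (3.19) p.393, (3.24) p.394, Thm 3.4 p.400;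
[Dimock2013] App. D Lemma 30, (coin).  0 `sorry`, 2 `def`.
-/

noncomputable section
open scoped BigOperators ComplexConjugate ComplexOrder InnerProductSpace Matrix.Norms.L2Operator
open Finset Matrix WithLp

namespace Summit.QuantumFields.YangMills.BalabanUVNodes.N15KingModelRung.Analytic

open Literature.MathematicalPhysics.QuantumFieldTheory.LatticeDiamagneticInequality (blk)
open Literature.MathematicalPhysics.QuantumFieldTheory.Balaban1983to89.B5Prop11Plancherel (Tor fine unitVec)
open Literature.MathematicalPhysics.QuantumFieldTheory.King1986.Torus
  (site blockOf blockOf_site blockEquiv blockEquiv_apply ctW abs_ctW_block_le tdistT tdistT_self tdistT_nonneg exists_eq_site)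
open Summit.QuantumFields.YangMills.BalabanUVNodes.N15KingModelRung.Covariant (fib fib_apply sum_norm_fib_sq norm_star_dotProduct_le l2_opNorm_of_mem_unitaryGroup_le)
open Summit.QuantumFields.YangMills.BalabanUVNodes.N15KingModelRung.Curvature (expWt)
open Summit.QuantumFields.YangMills.BalabanUVNodes.N15KingModelRung.CovariantBlock (BlockTree covQ covQ_apply_site kingQadjU fullOpU effLapU treeHol treeHol_mem_unitaryGroup)
open Summit.QuantumFields.YangMills.BalabanUVNodes.N15KingModelRung.CombesThomas
  (siteVec norm_siteVec ctRate ctRate_nonneg ctRate_le_one half_le_sub_rho_ctRate l2_opNorm_le_of_bilinear star_dotProduct_blk_mulVec star_dotProduct_mul_mul_mulVec norm_expWt_le_of_le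
    fib_conjTranspose_covQ_mulVec_siteVec ctW_le_on_block ctW_ge_on_block)

variable {d : ℕ} {L : ℕ} [NeZero L] (T : BlockTree d L) (M : Fin (d + 1) → ℕ) [hM : ∀ μ, NeZero (M μ)]
variable {𝕜 : Type*} [RCLike 𝕜] {n : Type*} [Fintype n] [DecidableEq n]

/-! ## §1 The continued `η`-adjoint and effective Laplacian -/

section Objects

/-- KING's `η`-ADJOINT CONTINUED: `Q♯_K(V) = L^{d+1}·Q♯(V)` (`= Q(U)^* = kingQadjU U` on the slice `V = Uᴴ`). [cite: King1986, (2.13) p.653; Balaban1985BackgroundPropagators, §3.B p.399 l.37–40] -/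
def cxKingQadj (V : Tor (fine L M) × Fin (d + 1) → Matrix n n 𝕜) : Matrix (Tor (fine L M) × n) (Tor M × n) 𝕜 := ((L : 𝕜) ^ (d + 1)) • cxQadj T M V

/-- KING's EFFECTIVE LAPLACIAN AT A TWO-SIDED COMPLEX FIELD: `Δ_eff(U,V) = a·1 − a²·Q(U)·G(U,V)·Q♯_K(V)`, `G(U,V) = A(U,V)⁻¹` — the holomorphic family through PART Ϥ-k's `effLapU`.
[cite: King1986, (2.14) p.653, (4.5) p.670; Balaban1985BackgroundPropagators, Thm 3.4 p.400] -/
def cxEffLap (a c m2 : ℝ) (U V : Tor (fine L M) × Fin (d + 1) → Matrix n n 𝕜) : Matrix (Tor M × n) (Tor M × n) 𝕜 :=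
  (a : 𝕜) • (1 : Matrix (Tor M × n) (Tor M × n) 𝕜) - ((a ^ 2 : ℝ) : 𝕜) • (covQ T M U * (cxFullOp T M a c m2 U V)⁻¹ * cxKingQadj T M V)

omit hM in
/-- ON THE ADJOINT SLICE: `Q♯_K(Uᴴ) = Q(U)^*`. [cite: King1986, (2.13) p.653] -/
theorem cxKingQadj_adjoint (U : Tor (fine L M) × Fin (d + 1) → Matrix n n 𝕜) : cxKingQadj T M (fun bd => (U bd)ᴴ) = kingQadjU T M U := by
  rw [cxKingQadj, cxQadj_adjoint, kingQadjU]

/-- ★★ **ON THE ADJOINT SLICE THE FAMILY IS KING's `Δ_eff(U)`**: `Δ_eff(U,Uᴴ) = effLapU T M a c m² U` for every `U`. [cite: King1986, (2.14) p.653, (4.5) p.670] -/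
theorem cxEffLap_adjoint (a c m2 : ℝ) (U : Tor (fine L M) × Fin (d + 1) → Matrix n n 𝕜) : cxEffLap T M a c m2 U (fun bd => (U bd)ᴴ) = effLapU T M a c m2 U := by
  rw [cxEffLap, cxFullOp_adjoint, cxKingQadj_adjoint, effLapU]

/-- ★ PRINT's SLICE THROUGH A UNITARY FIELD: `Δ_eff(U,U⁻¹) = Δ_eff(U)`. [cite: King1986, (2.14) p.653; Balaban1985BackgroundPropagators, §3.B p.399 l.37–40] -/
theorem cxEffLap_inv_of_unitary (a c m2 : ℝ) {U : Tor (fine L M) × Fin (d + 1) → Matrix n n 𝕜} (hU : ∀ bd, U bd ∈ Matrix.unitaryGroup n 𝕜) :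
    cxEffLap T M a c m2 U (fun bd => (U bd)⁻¹) = effLapU T M a c m2 U := by
  have h : (fun bd => (U bd)⁻¹) = fun bd => (U bd)ᴴ := by
    funext bd
    have h1 : (U bd)ᴴ * U bd = 1 := by simpa only [star_eq_conjTranspose] using Matrix.mem_unitaryGroup_iff'.mp (hU bd)
    exact Matrix.inv_eq_left_inv h1
  rw [h, cxEffLap_adjoint]

/-- The blocks of `Δ_eff(U,V)`: `aδ_{yy′}1 − a²·blk (Q(U)G(U,V)Q♯_K(V)) y y′`. [cite: King1986, (2.14) p.653] -/
theorem blk_cxEffLap (a c m2 : ℝ) (U V : Tor (fine L M) × Fin (d + 1) → Matrix n n 𝕜) (y y' : Tor M) :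
    blk (cxEffLap T M a c m2 U V) y y' = (if y = y' then (a : 𝕜) else 0) • (1 : Matrix n n 𝕜)
      - ((a ^ 2 : ℝ) : 𝕜) • blk (covQ T M U * (cxFullOp T M a c m2 U V)⁻¹ * cxKingQadj T M V) y y' := by
  ext i i'
  simp only [cxEffLap, blk, Matrix.of_apply, Matrix.sub_apply, Matrix.smul_apply, Matrix.one_apply, Prod.mk.injEq, smul_eq_mul]
  by_cases h : y = y' <;> by_cases h' : i = i' <;> simp [h, h']

end Objects

/-! ## §2 The test fields of the sandwich at a complex field -/

section TestFields

/-- THE FIBRES OF `Q(U)ᴴ(δ_y⊗u)` ON ITS BLOCK: at `x = site y j` it is `L^{−(d+1)}·U(Γ_j)ᴴu`. [cite: Balaban1985BackgroundPropagators, (3.19) p.393] -/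
theorem fib_conjTranspose_covQ_mulVec_siteVec_site (U : Tor (fine L M) × Fin (d + 1) → Matrix n n 𝕜) (y : Tor M) (u : n → 𝕜) (j : Fin (d + 1) → Fin L) :
    fib (fine L M) ((covQ T M U)ᴴ *ᵥ siteVec M y u) (site L M y j) = (toLp 2 ((((((L : ℝ) ^ (d + 1))⁻¹ : ℝ)) : 𝕜) • ((treeHol M T U y j)ᴴ *ᵥ u)) : EuclideanSpace 𝕜 n) := by
  have hc : star (((L : 𝕜) ^ (d + 1))⁻¹) = (((((L : ℝ) ^ (d + 1))⁻¹ : ℝ)) : 𝕜) := by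
    rw [RCLike.star_def, map_inv₀, map_pow, map_natCast]; push_cast; ring
  ext k
  rw [fib_apply, PiLp.toLp_apply, Pi.smul_apply, smul_eq_mul, Matrix.mulVec, dotProduct, Fintype.sum_prod_type, Finset.sum_eq_single y]
  · simp only [Matrix.conjTranspose_apply, covQ_apply_site, if_true, siteVec, Matrix.mulVec, dotProduct, Finset.mul_sum]
    refine Finset.sum_congr rfl fun i _ => ?_
    rw [star_mul', hc]; ring
  · intro b _ hb; exact Finset.sum_eq_zero fun i _ => by simp only [siteVec, if_neg hb, mul_zero]
  · intro h; exact absurd (Finset.mem_univ y) h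

/-- THE TEST FIELD `Q♯(V)(δ_{y′}⊗u′)` LIVES ON THE BLOCK `B(y′)`. [cite: Balaban1985BackgroundPropagators, (3.19) p.393] -/
theorem fib_cxQadj_mulVec_siteVec_of_ne (V : Tor (fine L M) × Fin (d + 1) → Matrix n n 𝕜) (y' : Tor M) (u' : n → 𝕜) {x : Tor (fine L M)} (hx : blockOf L M x ≠ y') :
    fib (fine L M) (cxQadj T M V *ᵥ siteVec M y' u') x = 0 := by
  obtain ⟨j, hj⟩ := exists_eq_site L M x
  ext k
  rw [fib_apply, hj, Matrix.mulVec, dotProduct, Fintype.sum_prod_type, Finset.sum_eq_single y']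
  · refine (Finset.sum_eq_zero fun i _ => ?_).trans rfl
    rw [cxQadj_apply_site, if_neg hx, zero_mul]
  · intro b _ hb; exact Finset.sum_eq_zero fun i _ => by simp only [siteVec, if_neg hb, mul_zero]
  · intro h; exact absurd (Finset.mem_univ y') h

/-- ITS FIBRES ON THE BLOCK: at `x = site y′ j` it is `L^{−(d+1)}·V(Γ_{x,y′})u′`. [cite: Balaban1985BackgroundPropagators, (3.19) p.393] -/
theorem fib_cxQadj_mulVec_siteVec_site (V : Tor (fine L M) × Fin (d + 1) → Matrix n n 𝕜) (y' : Tor M) (u' : n → 𝕜) (j : Fin (d + 1) → Fin L) :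
    fib (fine L M) (cxQadj T M V *ᵥ siteVec M y' u') (site L M y' j) = (toLp 2 ((((((L : ℝ) ^ (d + 1))⁻¹ : ℝ)) : 𝕜) • (treeHolRev M T V y' j *ᵥ u')) : EuclideanSpace 𝕜 n) := by
  have hc : ((L : 𝕜) ^ (d + 1))⁻¹ = (((((L : ℝ) ^ (d + 1))⁻¹ : ℝ)) : 𝕜) := by push_cast; ring
  ext k
  rw [fib_apply, PiLp.toLp_apply, Pi.smul_apply, smul_eq_mul, Matrix.mulVec, dotProduct, Fintype.sum_prod_type, Finset.sum_eq_single y']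
  · simp only [cxQadj_apply_site, if_true, siteVec, Matrix.mulVec, dotProduct, Finset.mul_sum]
    refine Finset.sum_congr rfl fun i _ => ?_
    rw [hc]; ring
  · intro b _ hb; exact Finset.sum_eq_zero fun i _ => by simp only [siteVec, if_neg hb, mul_zero]
  · intro h; exact absurd (Finset.mem_univ y') h

omit [DecidableEq n] in
/-- A FIELD SUPPORTED ON ONE BLOCK: `Σ_x‖v_x‖² = Σ_j‖v_{site y j}‖²` when `v` vanishes off `B(y)`. [folklore] -/
theorem sum_norm_fib_sq_block (v : Tor (fine L M) × n → 𝕜) (y : Tor M) (hv : ∀ x, blockOf L M x ≠ y → fib (fine L M) v x = 0) :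
    ∑ x, ‖fib (fine L M) v x‖ ^ 2 = ∑ j : Fin (d + 1) → Fin L, ‖fib (fine L M) v (site L M y j)‖ ^ 2 := by
  rw [← (blockEquiv L M).sum_comp, Fintype.sum_prod_type, Finset.sum_eq_single y]
  · rfl
  · intro b _ hb
    exact Finset.sum_eq_zero fun j _ => by rw [blockEquiv_apply, hv _ (by rw [blockOf_site]; exact hb), norm_zero]; ring
  · intro h; exact absurd (Finset.mem_univ y) h

omit [NeZero L] hM in
/-- `‖r•(Wu)‖ ≤ |r|·‖W‖·‖u‖` in `𝕜ⁿ`. [folklore] -/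
theorem norm_toLp_smul_mulVec_le (r : ℝ) (W : Matrix n n 𝕜) (u : n → 𝕜) :
    ‖(toLp 2 ((((r : ℝ)) : 𝕜) • (W *ᵥ u)) : EuclideanSpace 𝕜 n)‖ ≤ |r| * (‖W‖ * ‖(toLp 2 u : EuclideanSpace 𝕜 n)‖) := by
  rw [WithLp.toLp_smul, norm_smul, RCLike.norm_ofReal]
  exact mul_le_mul_of_nonneg_left (Matrix.l2_opNorm_mulVec W _) (abs_nonneg r)

variable {D : ℕ} (hD : ∀ j, T.depth j ≤ D) {U₀ U V : Tor (fine L M) × Fin (d + 1) → Matrix n n 𝕜} (hU₀ : ∀ bd, U₀ bd ∈ Matrix.unitaryGroup n 𝕜) {ε : ℝ} (hε0 : 0 ≤ ε)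
  (hU : ∀ bd, ‖U bd - U₀ bd‖ ≤ ε) (hV : ∀ bd, ‖V bd - (U₀ bd)ᴴ‖ ≤ ε)
include hD hU₀ hε0

include hU in
/-- ★ THE SIZE OF THE LEFT TEST FIELD: `‖Q(U)ᴴ(δ_y⊗u)‖² ≤ L^{−(d+1)}·((1+ε)^{D}‖u‖)²` for `U` within `ε` of the unitary `U₀`. [cite: Balaban1985BackgroundPropagators, (3.19) p.393] -/
theorem norm_sq_conjTranspose_covQ_siteVec_le (y : Tor M) (u : n → 𝕜) :
    ‖(toLp 2 ((covQ T M U)ᴴ *ᵥ siteVec M y u) : EuclideanSpace 𝕜 (Tor (fine L M) × n))‖ ^ 2 ≤ ((L : ℝ) ^ (d + 1))⁻¹ * ((1 + ε) ^ D * ‖(toLp 2 u : EuclideanSpace 𝕜 n)‖) ^ 2 := by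
  have hL0 : (0 : ℝ) < (L : ℝ) ^ (d + 1) := by have : (0 : ℝ) < L := (by exact_mod_cast Nat.pos_of_ne_zero (NeZero.ne L)); positivity
  have hr : (1 : ℝ) ≤ 1 + ε := by linarith
  rw [← sum_norm_fib_sq, sum_norm_fib_sq_block M _ y (fun x hx => fib_conjTranspose_covQ_mulVec_siteVec T M U y u hx)]
  have hterm : ∀ j : Fin (d + 1) → Fin L, ‖fib (fine L M) ((covQ T M U)ᴴ *ᵥ siteVec M y u) (site L M y j)‖ ^ 2 ≤ (((L : ℝ) ^ (d + 1))⁻¹ * ((1 + ε) ^ D * ‖(toLp 2 u : EuclideanSpace 𝕜 n)‖)) ^ 2 := by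
    intro j
    rw [fib_conjTranspose_covQ_mulVec_siteVec_site]
    refine pow_le_pow_left₀ (norm_nonneg _) ((norm_toLp_smul_mulVec_le _ _ _).trans ?_) 2
    rw [abs_of_pos (inv_pos.2 hL0), Matrix.l2_opNorm_conjTranspose]
    exact mul_le_mul_of_nonneg_left (mul_le_mul_of_nonneg_right ((norm_treeHol_le_pow_of_near T M hU₀ hε0 hU y j).trans (pow_le_pow_right₀ hr (hD j))) (norm_nonneg _)) (by positivity)
  calc ∑ j : Fin (d + 1) → Fin L, ‖fib (fine L M) ((covQ T M U)ᴴ *ᵥ siteVec M y u) (site L M y j)‖ ^ 2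
      ≤ ∑ _j : Fin (d + 1) → Fin L, (((L : ℝ) ^ (d + 1))⁻¹ * ((1 + ε) ^ D * ‖(toLp 2 u : EuclideanSpace 𝕜 n)‖)) ^ 2 := Finset.sum_le_sum fun j _ => hterm j
    _ = ((L : ℝ) ^ (d + 1))⁻¹ * ((1 + ε) ^ D * ‖(toLp 2 u : EuclideanSpace 𝕜 n)‖) ^ 2 := by
        rw [Finset.sum_const, Finset.card_univ, Fintype.card_fun, Fintype.card_fin, Fintype.card_fin, nsmul_eq_mul, mul_pow, mul_pow]
        push_cast
        try field_simp

include hV in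
/-- ★ THE SIZE OF THE RIGHT TEST FIELD: `‖Q♯(V)(δ_{y′}⊗u′)‖² ≤ L^{−(d+1)}·((1+ε)^{D}‖u′‖)²` for `V` within `ε` of `U₀ᴴ`. [cite: Balaban1985BackgroundPropagators, (3.19) p.393, §3.B p.399 l.37–40] -/
theorem norm_sq_cxQadj_siteVec_le (y' : Tor M) (u' : n → 𝕜) :
    ‖(toLp 2 (cxQadj T M V *ᵥ siteVec M y' u') : EuclideanSpace 𝕜 (Tor (fine L M) × n))‖ ^ 2 ≤ ((L : ℝ) ^ (d + 1))⁻¹ * ((1 + ε) ^ D * ‖(toLp 2 u' : EuclideanSpace 𝕜 n)‖) ^ 2 := by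
  have hL0 : (0 : ℝ) < (L : ℝ) ^ (d + 1) := by have : (0 : ℝ) < L := (by exact_mod_cast Nat.pos_of_ne_zero (NeZero.ne L)); positivity
  have hr : (1 : ℝ) ≤ 1 + ε := by linarith
  rw [← sum_norm_fib_sq, sum_norm_fib_sq_block M _ y' (fun x hx => fib_cxQadj_mulVec_siteVec_of_ne T M V y' u' hx)]
  have hterm : ∀ j : Fin (d + 1) → Fin L, ‖fib (fine L M) (cxQadj T M V *ᵥ siteVec M y' u') (site L M y' j)‖ ^ 2 ≤ (((L : ℝ) ^ (d + 1))⁻¹ * ((1 + ε) ^ D * ‖(toLp 2 u' : EuclideanSpace 𝕜 n)‖)) ^ 2 := by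
    intro j
    rw [fib_cxQadj_mulVec_siteVec_site]
    refine pow_le_pow_left₀ (norm_nonneg _) ((norm_toLp_smul_mulVec_le _ _ _).trans ?_) 2
    rw [abs_of_pos (inv_pos.2 hL0)]
    exact mul_le_mul_of_nonneg_left (mul_le_mul_of_nonneg_right ((norm_treeHolRev_le_pow_of_near T M hU₀ hε0 hV y' j).trans (pow_le_pow_right₀ hr (hD j))) (norm_nonneg _)) (by positivity)
  calc ∑ j : Fin (d + 1) → Fin L, ‖fib (fine L M) (cxQadj T M V *ᵥ siteVec M y' u') (site L M y' j)‖ ^ 2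
      ≤ ∑ _j : Fin (d + 1) → Fin L, (((L : ℝ) ^ (d + 1))⁻¹ * ((1 + ε) ^ D * ‖(toLp 2 u' : EuclideanSpace 𝕜 n)‖)) ^ 2 := Finset.sum_le_sum fun j _ => hterm j
    _ = ((L : ℝ) ^ (d + 1))⁻¹ * ((1 + ε) ^ D * ‖(toLp 2 u' : EuclideanSpace 𝕜 n)‖) ^ 2 := by
        rw [Finset.sum_const, Finset.card_univ, Fintype.card_fun, Fintype.card_fin, Fintype.card_fin, nsmul_eq_mul, mul_pow, mul_pow]
        push_cast
        try field_simp

end TestFields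

/-! ## §3 The sandwich and `Δ_eff(U,V)` decay in the complex window -/

section Window

variable {D : ℕ} (hD : ∀ j, T.depth j ≤ D)
variable {a c m2 : ℝ} (ha : 0 ≤ a) (hc : 0 ≤ c) (hm : 0 ≤ m2) (hL : 1 ≤ L)
variable {U₀ : Tor (fine L M) × Fin (d + 1) → Matrix n n 𝕜} (hU₀ : ∀ bd, U₀ bd ∈ Matrix.unitaryGroup n 𝕜)
variable {κ : ℝ} (hcoer : ∀ v : Tor (fine L M) × n → 𝕜, κ * ∑ x, ‖fib (fine L M) v x‖ ^ 2 ≤ RCLike.re (star v ⬝ᵥ (fullOpU T M a c m2 U₀ *ᵥ v)))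
variable {U V : Tor (fine L M) × Fin (d + 1) → Matrix n n 𝕜} {ε₁ ε₂ : ℝ} (hε₁ : 0 ≤ ε₁)
  (hU : ∀ bd, ‖U bd - U₀ bd‖ ≤ ε₁) (hV : ∀ bd, ‖V bd - (U₀ bd)ᴴ‖ ≤ ε₁) (h0 : ∀ bd, ‖(U bd - U₀ bd) * (U₀ bd)ᴴ + U₀ bd * (V bd - (U₀ bd)ᴴ)‖ ≤ ε₂)
include hD ha hc hm hL hU₀ hcoer hε₁ hU hV h0

/-- ★★★ **THE CONTINUED SANDWICH DECAYS ON THE BLOCK SCALE IN THE COMPLEX WINDOW**: with PART Ϩ-e's weighted budget `γ > 0` at rate `κ_w ∈ [0,1]`,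
`‖blk (Q(U)G(U,V)Q♯_K(V)) y y′‖ ≤ γ⁻¹·e²·(1+ε₁)^{2D}·e^{−κ_w·d_M(y,y′)}` (Dimock's Lemma 30 in the window with the continued test fields). [cite: Dimock2013, App. D, Lemma 30, (coin); King1986, (4.34) p.674; Balaban1985BackgroundPropagators, Thm 3.4 p.400] -/
theorem norm_blk_cxSandwich_le_of_near {κw γ : ℝ} (hκw : 0 ≤ κw) (hκw1 : κw ≤ 1) (hγ : 0 < γ)
    (hbud : γ ≤ κ / 2 - (2 * ((d : ℝ) + 1) * c * (Real.cosh (κw / L) - 1) + a * (Real.cosh κw - 1))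
        - c * ((d : ℝ) + 1) * ((Real.exp (κw / L) * ε₂ + 2 * (Real.exp (κw / L) - 1) * ε₁) + 2 * (Real.exp (κw / L) * ε₁) ^ 2)
        - Real.exp κw * (a * ((1 + ε₁) ^ (2 * D) - 1))) (y y' : Tor M) :
    ‖blk (covQ T M U * (cxFullOp T M a c m2 U V)⁻¹ * cxKingQadj T M V) y y'‖ ≤ γ⁻¹ * Real.exp 2 * (1 + ε₁) ^ (2 * D) * Real.exp (-(κw * tdistT M y y')) := by
  have hLr0 : (0 : ℝ) < (L : ℝ) ^ (d + 1) := by have : (0 : ℝ) < L := (by exact_mod_cast hL); positivity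
  have hr : (1 : ℝ) ≤ 1 + ε₁ := by linarith
  set G := (cxFullOp T M a c m2 U V)⁻¹ with hG
  refine l2_opNorm_le_of_bilinear _ (by positivity) fun u u' => ?_
  set f : Tor (fine L M) × n → 𝕜 := (covQ T M U)ᴴ *ᵥ siteVec M y u with hf
  set g : Tor (fine L M) × n → 𝕜 := cxKingQadj T M V *ᵥ siteVec M y' u' with hg
  have hpair : star u ⬝ᵥ (blk (covQ T M U * G * cxKingQadj T M V) y y' *ᵥ u') = star f ⬝ᵥ (G *ᵥ g) := by
    rw [star_dotProduct_blk_mulVec, star_dotProduct_mul_mul_mulVec]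
  have hD' := norm_star_dotProduct_cxFullOp_inv_mulVec_le_of_near T M hD ha hc hm hU₀ hcoer hε₁ hU hV h0 hκw hγ hbud (site L M y' T.root) f g
  have hg' : g = (((L : ℝ) ^ (d + 1) : ℝ) : 𝕜) • (cxQadj T M V *ᵥ siteVec M y' u') := by
    rw [hg, cxKingQadj, Matrix.smul_mulVec]; push_cast; rfl
  -- weights on the supports
  have hfw : ‖(toLp 2 (expWt (fine L M) (fun x => -ctW L M κw (site L M y' T.root) x) f) : EuclideanSpace 𝕜 (Tor (fine L M) × n))‖
      ≤ Real.exp (κw - κw * tdistT M y y') * ‖(toLp 2 f : EuclideanSpace 𝕜 (Tor (fine L M) × n))‖ := by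
    refine norm_expWt_le_of_le _ f fun x hx => ?_
    have hbx : blockOf L M x = y := by
      by_contra hne; exact hx (fib_conjTranspose_covQ_mulVec_siteVec T M U y u hne)
    have := ctW_ge_on_block (L := L) M hL hκw y y' T.root hbx
    linarith
  have hgw : ‖(toLp 2 (expWt (fine L M) (ctW L M κw (site L M y' T.root)) g) : EuclideanSpace 𝕜 (Tor (fine L M) × n))‖ ≤ Real.exp κw * ‖(toLp 2 g : EuclideanSpace 𝕜 (Tor (fine L M) × n))‖ := by
    refine norm_expWt_le_of_le _ g fun x hx => ?_
    have hbx : blockOf L M x = y' := by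
      by_contra hne
      apply hx
      have h0 := fib_cxQadj_mulVec_siteVec_of_ne T M V y' u' hne
      have h0' : ∀ k, (cxQadj T M V *ᵥ siteVec M y' u') (x, k) = 0 := fun k => by
        have := congr_fun (congrArg ofLp h0) k
        simpa only [fib, WithLp.ofLp_toLp, WithLp.ofLp_zero, Pi.zero_apply] using this
      ext k
      rw [fib_apply, hg', Pi.smul_apply, smul_eq_mul, h0', mul_zero]; rfl
    exact ctW_le_on_block (L := L) M hκw y' T.root hbx
  -- sizes of the test fields: `‖f‖‖g‖ ≤ (1+ε₁)^{2D}‖u‖‖u′‖`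
  have hfg : ‖(toLp 2 f : EuclideanSpace 𝕜 (Tor (fine L M) × n))‖ * ‖(toLp 2 g : EuclideanSpace 𝕜 (Tor (fine L M) × n))‖
      ≤ (1 + ε₁) ^ (2 * D) * (‖(toLp 2 u : EuclideanSpace 𝕜 n)‖ * ‖(toLp 2 u' : EuclideanSpace 𝕜 n)‖) := by
    have h1 := norm_sq_conjTranspose_covQ_siteVec_le T M hD hU₀ hε₁ hU y u
    have h2 := norm_sq_cxQadj_siteVec_le T M hD hU₀ hε₁ hV y' u'
    have hgn : ‖(toLp 2 g : EuclideanSpace 𝕜 (Tor (fine L M) × n))‖ = (L : ℝ) ^ (d + 1) * ‖(toLp 2 (cxQadj T M V *ᵥ siteVec M y' u') : EuclideanSpace 𝕜 (Tor (fine L M) × n))‖ := by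
      rw [hg', WithLp.toLp_smul, norm_smul, RCLike.norm_ofReal, abs_of_pos hLr0]
    have hsq : (‖(toLp 2 f : EuclideanSpace 𝕜 (Tor (fine L M) × n))‖ * ‖(toLp 2 g : EuclideanSpace 𝕜 (Tor (fine L M) × n))‖) ^ 2
        ≤ ((1 + ε₁) ^ (2 * D) * (‖(toLp 2 u : EuclideanSpace 𝕜 n)‖ * ‖(toLp 2 u' : EuclideanSpace 𝕜 n)‖)) ^ 2 := by
      rw [mul_pow, hgn, mul_pow, hf]
      have e : ((1 + ε₁) ^ (2 * D) * (‖(toLp 2 u : EuclideanSpace 𝕜 n)‖ * ‖(toLp 2 u' : EuclideanSpace 𝕜 n)‖)) ^ 2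
          = (((L : ℝ) ^ (d + 1))⁻¹ * ((1 + ε₁) ^ D * ‖(toLp 2 u : EuclideanSpace 𝕜 n)‖) ^ 2) * (((L : ℝ) ^ (d + 1)) ^ 2 * (((L : ℝ) ^ (d + 1))⁻¹ * ((1 + ε₁) ^ D * ‖(toLp 2 u' : EuclideanSpace 𝕜 n)‖) ^ 2)) := by
        field_simp; ring
      rw [e]
      exact mul_le_mul h1 (mul_le_mul_of_nonneg_left h2 (by positivity)) (by positivity) (by positivity)
    exact (abs_le_of_sq_le_sq' hsq (by positivity)).2
  rw [hpair]
  have hγ0 : 0 ≤ γ⁻¹ := inv_nonneg.2 hγ.le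
  calc ‖star f ⬝ᵥ (G *ᵥ g)‖
      ≤ γ⁻¹ * ‖(toLp 2 (expWt (fine L M) (fun x => -ctW L M κw (site L M y' T.root) x) f) : EuclideanSpace 𝕜 (Tor (fine L M) × n))‖
          * ‖(toLp 2 (expWt (fine L M) (ctW L M κw (site L M y' T.root)) g) : EuclideanSpace 𝕜 (Tor (fine L M) × n))‖ := hD'
    _ ≤ γ⁻¹ * (Real.exp (κw - κw * tdistT M y y') * ‖(toLp 2 f : EuclideanSpace 𝕜 (Tor (fine L M) × n))‖)
          * (Real.exp κw * ‖(toLp 2 g : EuclideanSpace 𝕜 (Tor (fine L M) × n))‖) := by gcongr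
    _ = γ⁻¹ * (Real.exp (κw - κw * tdistT M y y') * Real.exp κw) * (‖(toLp 2 f : EuclideanSpace 𝕜 (Tor (fine L M) × n))‖ * ‖(toLp 2 g : EuclideanSpace 𝕜 (Tor (fine L M) × n))‖) := by ring
    _ ≤ γ⁻¹ * (Real.exp 2 * Real.exp (-(κw * tdistT M y y'))) * ((1 + ε₁) ^ (2 * D) * (‖(toLp 2 u : EuclideanSpace 𝕜 n)‖ * ‖(toLp 2 u' : EuclideanSpace 𝕜 n)‖)) := by
        rw [← Real.exp_add, ← Real.exp_add]
        exact mul_le_mul (mul_le_mul_of_nonneg_left (Real.exp_le_exp.mpr (by linarith)) hγ0) hfg (by positivity) (by positivity)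
    _ = γ⁻¹ * Real.exp 2 * (1 + ε₁) ^ (2 * D) * Real.exp (-(κw * tdistT M y y')) * ‖(toLp 2 u : EuclideanSpace 𝕜 n)‖ * ‖(toLp 2 u' : EuclideanSpace 𝕜 n)‖ := by ring

/-- ★★★ **KING's (4.34)(ii) AT A COMPLEX LINK FIELD**: in the same window, `‖blk Δ_eff(U,V) y y′‖ ≤ (a + a²·γ⁻¹e²(1+ε₁)^{2D})·e^{−κ_w·d_M(y,y′)}`.
[cite: King1986, (2.14) p.653, (4.34) p.674; Balaban1985BackgroundPropagators, Thm 3.4 p.400] -/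
theorem norm_blk_cxEffLap_le_of_near {κw γ : ℝ} (hκw : 0 ≤ κw) (hκw1 : κw ≤ 1) (hγ : 0 < γ)
    (hbud : γ ≤ κ / 2 - (2 * ((d : ℝ) + 1) * c * (Real.cosh (κw / L) - 1) + a * (Real.cosh κw - 1))
        - c * ((d : ℝ) + 1) * ((Real.exp (κw / L) * ε₂ + 2 * (Real.exp (κw / L) - 1) * ε₁) + 2 * (Real.exp (κw / L) * ε₁) ^ 2)
        - Real.exp κw * (a * ((1 + ε₁) ^ (2 * D) - 1))) (y y' : Tor M) :
    ‖blk (cxEffLap T M a c m2 U V) y y'‖ ≤ (a + a ^ 2 * (γ⁻¹ * Real.exp 2 * (1 + ε₁) ^ (2 * D))) * Real.exp (-(κw * tdistT M y y')) := by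
  have hS := norm_blk_cxSandwich_le_of_near T M hD ha hc hm hL hU₀ hcoer hε₁ hU hV h0 hκw hκw1 hγ hbud y y'
  have hE : 0 < Real.exp (-(κw * tdistT M y y')) := Real.exp_pos _
  rw [blk_cxEffLap]
  refine (norm_sub_le _ _).trans ?_
  have h1 : ‖(if y = y' then (a : 𝕜) else 0) • (1 : Matrix n n 𝕜)‖ ≤ a * Real.exp (-(κw * tdistT M y y')) := by
    by_cases hyy : y = y'
    · subst hyy
      rw [if_pos rfl, tdistT_self, mul_zero, neg_zero, Real.exp_zero, mul_one, norm_smul, RCLike.norm_ofReal, abs_of_nonneg ha]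
      calc a * ‖(1 : Matrix n n 𝕜)‖ ≤ a * 1 := mul_le_mul_of_nonneg_left (by rw [Matrix.cstar_norm_def, map_one]; exact ContinuousLinearMap.norm_id_le) ha
        _ = a := mul_one a
    · rw [if_neg hyy, zero_smul, norm_zero]; positivity
  have h2 : ‖((a ^ 2 : ℝ) : 𝕜) • blk (covQ T M U * (cxFullOp T M a c m2 U V)⁻¹ * cxKingQadj T M V) y y'‖
      ≤ a ^ 2 * (γ⁻¹ * Real.exp 2 * (1 + ε₁) ^ (2 * D)) * Real.exp (-(κw * tdistT M y y')) := by
    rw [norm_smul, RCLike.norm_ofReal, abs_of_nonneg (sq_nonneg a), mul_assoc]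
    exact mul_le_mul_of_nonneg_left (by simpa only [mul_assoc] using hS) (sq_nonneg a)
  calc _ ≤ a * Real.exp (-(κw * tdistT M y y')) + a ^ 2 * (γ⁻¹ * Real.exp 2 * (1 + ε₁) ^ (2 * D)) * Real.exp (-(κw * tdistT M y y')) := add_le_add h1 h2
    _ = _ := by ring

end Window

/-! ## §4 King's scaling on print's slice at Bałaban's radius -/

section Radius

variable (hD : ∀ j, T.depth j ≤ (d + 1) * (L - 1)) {a m2 : ℝ} (ha : 0 ≤ a) (hm : 0 ≤ m2) (hL : 1 ≤ L)
variable {U₀ : Tor (fine L M) × Fin (d + 1) → Matrix n n 𝕜} (hU₀ : ∀ bd, U₀ bd ∈ Matrix.unitaryGroup n 𝕜)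
variable {κ : ℝ} (hκ : 0 < κ) (hcoer : ∀ v : Tor (fine L M) × n → 𝕜, κ * ∑ x, ‖fib (fine L M) v x‖ ^ 2 ≤ RCLike.re (star v ⬝ᵥ (fullOpU T M a ((L : ℝ) ^ 2) m2 U₀ *ᵥ v)))
variable {U : Tor (fine L M) × Fin (d + 1) → Matrix n n 𝕜} {ε : ℝ} (hε0 : 0 ≤ ε) (hU : ∀ bd, ‖U bd - U₀ bd‖ ≤ ε) (hrad : (L : ℝ) * ε ≤ sliceRadius κ a d)
include hD ha hm hL hU₀ hκ hcoer hε0 hU hrad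

/-- ★★★ **THE CONTINUED SANDWICH AT THE RADIUS** (print's slice, King's scaling, comb-depth contours): `‖blk (Q(U)G(U,U⁻¹)Q♯_K(U⁻¹)) y y′‖ ≤ (8∕κ)·e³·e^{−ctRate(κ∕2,a,d)·d_M(y,y′)}`
(`(1+2ε)^{2D} ≤ e^{4(d+1)s} ≤ e` at the radius). [cite: King1986, (4.34) p.674; Dimock2013, App. D, Lemma 30; Balaban1985BackgroundPropagators, Thm 3.4 p.400] -/
theorem norm_blk_cxSandwich_at_radius_le (y y' : Tor M) :
    ‖blk (covQ T M U * (cxFullOp T M a ((L : ℝ) ^ 2) m2 U (fun bd => (U bd)⁻¹))⁻¹ * cxKingQadj T M (fun bd => (U bd)⁻¹)) y y'‖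
      ≤ 8 / κ * Real.exp 3 * Real.exp (-(ctRate (κ / 2) a d * tdistT M y y')) := by
  have hL0 : (0 : ℝ) < L := by exact_mod_cast hL
  -- at the radius
  have hεh : ε ≤ 1 / 2 := by
    have h := hrad.trans (sliceRadius_le κ a d).1
    have hd : (4 : ℝ) ≤ 4 * ((d : ℝ) + 1) := by have : (0 : ℝ) ≤ d := Nat.cast_nonneg d; linarith
    have h2 : (L : ℝ) * ε ≤ 1 / 4 := h.trans (one_div_le_one_div_of_le (by norm_num) hd)
    have hL1 : (1 : ℝ) ≤ L := by exact_mod_cast hL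
    nlinarith
  have hs := slice_budgets hκ ha (mul_nonneg hL0.le hε0) hrad (d := d)
  have hτ := tau_slice_le (d := d) hL (D := (d + 1) * (L - 1)) le_rfl (mul_nonneg hL0.le hε0)
  rw [mul_div_cancel_left₀ ε hL0.ne'] at hτ
  -- the exponential at the radius: `e^{4(d+1)s} ≤ e`
  have hx1 : 4 * ((d : ℝ) + 1) * ((L : ℝ) * ε) ≤ 1 := by
    have h := hrad.trans (sliceRadius_le κ a d).1
    rw [le_div_iff₀ (by positivity)] at h; linarith
  have hτe : (1 + 2 * ε) ^ (2 * ((d + 1) * (L - 1))) ≤ Real.exp 1 := by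
    have := Real.exp_le_exp.2 hx1; linarith
  -- the weighted budget (Ϩ-e bookkeeping) at rate `ctRate(κ∕2)`
  set κw := ctRate (κ / 2) a d with hκwdef
  have hκw0 : 0 ≤ κw := ctRate_nonneg _ _ _
  have hκw1 : κw ≤ 1 := ctRate_le_one _ _ _
  have hρ := half_le_sub_rho_ctRate (d := d) hL (by positivity : 0 < κ / 2) ha
  have hbook := king_tilt_bookkeeping hL hκw0 hκw1 (by linarith : (0 : ℝ) ≤ 2 * ε) (by positivity : (0 : ℝ) ≤ 2 * ε ^ 2)
  have heκ : Real.exp κw ≤ Real.exp 1 := Real.exp_le_exp.2 hκw1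
  have hτa : 0 ≤ a * ((1 + 2 * ε) ^ (2 * ((d + 1) * (L - 1))) - 1) := mul_nonneg ha (sub_nonneg.2 (one_le_pow₀ (by linarith)))
  have he0 : 0 ≤ Real.exp 1 := (Real.exp_pos 1).le
  have hbud : κ / 8 ≤ κ / 2 - (2 * ((d : ℝ) + 1) * (L : ℝ) ^ 2 * (Real.cosh (κw / L) - 1) + a * (Real.cosh κw - 1))
        - (L : ℝ) ^ 2 * ((d : ℝ) + 1) * ((Real.exp (κw / L) * (2 * ε ^ 2) + 2 * (Real.exp (κw / L) - 1) * (2 * ε)) + 2 * (Real.exp (κw / L) * (2 * ε)) ^ 2)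
        - Real.exp κw * (a * ((1 + 2 * ε) ^ (2 * ((d + 1) * (L - 1))) - 1)) := by
    have hc2 : (L : ℝ) ^ 2 * ((d : ℝ) + 1) * ((Real.exp (κw / L) * (2 * ε ^ 2) + 2 * (Real.exp (κw / L) - 1) * (2 * ε)) + 2 * (Real.exp (κw / L) * (2 * ε)) ^ 2)
        ≤ ((d : ℝ) + 1) * (Real.exp 1 * ((L : ℝ) ^ 2 * (2 * ε ^ 2) + 2 * ((L : ℝ) * (2 * ε))) + 2 * Real.exp 1 ^ 2 * ((L : ℝ) * (2 * ε)) ^ 2) := by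
      have : (L : ℝ) ^ 2 * ((d : ℝ) + 1) * ((Real.exp (κw / L) * (2 * ε ^ 2) + 2 * (Real.exp (κw / L) - 1) * (2 * ε)) + 2 * (Real.exp (κw / L) * (2 * ε)) ^ 2)
          = ((d : ℝ) + 1) * ((L : ℝ) ^ 2 * ((Real.exp (κw / L) * (2 * ε ^ 2) + 2 * (Real.exp (κw / L) - 1) * (2 * ε)) + 2 * (Real.exp (κw / L) * (2 * ε)) ^ 2)) := by ring
      rw [this]; exact mul_le_mul_of_nonneg_left hbook (by positivity)
    have hblock : Real.exp κw * (a * ((1 + 2 * ε) ^ (2 * ((d + 1) * (L - 1))) - 1)) ≤ Real.exp 1 * (a * ((1 + 2 * ε) ^ (2 * ((d + 1) * (L - 1))) - 1)) := mul_le_mul_of_nonneg_right heκ hτa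
    have e : ((d : ℝ) + 1) * (Real.exp 1 * ((L : ℝ) ^ 2 * (2 * ε ^ 2) + 2 * ((L : ℝ) * (2 * ε))) + 2 * Real.exp 1 ^ 2 * ((L : ℝ) * (2 * ε)) ^ 2)
        = ((d : ℝ) + 1) * (Real.exp 1 * (2 * ((L : ℝ) * ε) ^ 2 + 4 * ((L : ℝ) * ε)) + 8 * Real.exp 1 ^ 2 * ((L : ℝ) * ε) ^ 2) := by ring
    rw [e] at hc2
    nlinarith [hs.2, mul_le_mul_of_nonneg_left (mul_le_mul_of_nonneg_left hτ ha) he0]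
  have h := norm_blk_cxSandwich_le_of_near T M hD ha (by positivity) hm hL hU₀ hcoer (by linarith : (0 : ℝ) ≤ 2 * ε) (slice_near_fwd M hU) (slice_near_bwd M hU₀ hU hεh) (slice_near_zeroth M hU₀ hU hεh)
    hκw0 hκw1 (by positivity : 0 < κ / 8) hbud y y'
  refine h.trans ?_
  have e8 : (κ / 8)⁻¹ = 8 / κ := by rw [inv_div]
  rw [e8]
  have hexp3 : Real.exp 2 * (1 + 2 * ε) ^ (2 * ((d + 1) * (L - 1))) ≤ Real.exp 3 := by
    calc Real.exp 2 * (1 + 2 * ε) ^ (2 * ((d + 1) * (L - 1))) ≤ Real.exp 2 * Real.exp 1 := mul_le_mul_of_nonneg_left hτe (Real.exp_nonneg _)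
      _ = Real.exp 3 := by rw [← Real.exp_add]; norm_num
  have hκ8 : 0 ≤ 8 / κ := by positivity
  calc 8 / κ * Real.exp 2 * (1 + 2 * ε) ^ (2 * ((d + 1) * (L - 1))) * Real.exp (-(κw * tdistT M y y'))
      = 8 / κ * (Real.exp 2 * (1 + 2 * ε) ^ (2 * ((d + 1) * (L - 1)))) * Real.exp (-(κw * tdistT M y y')) := by ring
    _ ≤ 8 / κ * Real.exp 3 * Real.exp (-(κw * tdistT M y y')) := by gcongr

/-- ★★★★ **KING's (4.34)(ii) IN THE COMPLEX POLYDISC, `η`-UNIFORMLY**: for every `L ≥ 1`, volume, fibre, comb-depth contour system, unitary `κ`-coercive `U₀` (King's scaling) and every complex `U`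
with `‖U_b − U₀_b‖ ≤ ε`, `Lε ≤ s₀(κ,a,d)`:  `‖blk Δ_eff(U,U⁻¹) y y′‖ ≤ (a + a²(8∕κ)e³)·e^{−ctRate(κ∕2,a,d)·d_M(y,y′)}` — the tree's `effLaplacian_decay` shape `C_Δe^{−κd(b,b′)}` for the holomorphically
continued effective Laplacian, constants depending on `(κ,a,d)` only. [cite: King1986, (2.14) p.653, (4.34) p.674; Balaban1985BackgroundPropagators, Thm 3.4 p.400; Dimock2013, App. D, (coin)] -/
theorem norm_blk_cxEffLap_at_radius_le (y y' : Tor M) :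
    ‖blk (cxEffLap T M a ((L : ℝ) ^ 2) m2 U (fun bd => (U bd)⁻¹)) y y'‖ ≤ (a + a ^ 2 * (8 / κ * Real.exp 3)) * Real.exp (-(ctRate (κ / 2) a d * tdistT M y y')) := by
  have hS := norm_blk_cxSandwich_at_radius_le T M hD ha hm hL hU₀ hκ hcoer hε0 hU hrad y y'
  rw [blk_cxEffLap]
  refine (norm_sub_le _ _).trans ?_
  have h1 : ‖(if y = y' then (a : 𝕜) else 0) • (1 : Matrix n n 𝕜)‖ ≤ a * Real.exp (-(ctRate (κ / 2) a d * tdistT M y y')) := by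
    by_cases hyy : y = y'
    · subst hyy
      rw [if_pos rfl, tdistT_self, mul_zero, neg_zero, Real.exp_zero, mul_one, norm_smul, RCLike.norm_ofReal, abs_of_nonneg ha]
      calc a * ‖(1 : Matrix n n 𝕜)‖ ≤ a * 1 := mul_le_mul_of_nonneg_left (by rw [Matrix.cstar_norm_def, map_one]; exact ContinuousLinearMap.norm_id_le) ha
        _ = a := mul_one a
    · rw [if_neg hyy, zero_smul, norm_zero]; positivity
  have h2 : ‖((a ^ 2 : ℝ) : 𝕜) • blk (covQ T M U * (cxFullOp T M a ((L : ℝ) ^ 2) m2 U (fun bd => (U bd)⁻¹))⁻¹ * cxKingQadj T M (fun bd => (U bd)⁻¹)) y y'‖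
      ≤ a ^ 2 * (8 / κ * Real.exp 3) * Real.exp (-(ctRate (κ / 2) a d * tdistT M y y')) := by
    rw [norm_smul, RCLike.norm_ofReal, abs_of_nonneg (sq_nonneg a), mul_assoc]
    exact mul_le_mul_of_nonneg_left hS (sq_nonneg a)
  calc _ ≤ a * Real.exp (-(ctRate (κ / 2) a d * tdistT M y y')) + a ^ 2 * (8 / κ * Real.exp 3) * Real.exp (-(ctRate (κ / 2) a d * tdistT M y y')) := add_le_add h1 h2
    _ = _ := by ring

end Radius

end Summit.QuantumFields.YangMills.BalabanUVNodes.N15KingModelRung.Analytic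

end
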